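import Summits.HubbardSuperconductivity.HubbardSuperconductivity.Theorems.AnisotropyChordTransferFibre3FinX3Eval

/-!
# Route `AnisotropyChord` / H0 rotor rung: FIN per-`L` GM₃ (X4), `L = 25` — rows `N₁` / D / side-condition cell facts, part `p27`

Kernel facts (`decide +kernel`) for cert cells 73, 74 of the per-`L` grid of `L = 25`: `xbnCellAny2` (row `N₁` on XB2 point wedges recomputed in the kernel, exporting the literal brackets `nt ⊇ T⁺ − 3λ₂` and `tb ⊇ T⁺·D`), `xdCellAnyN0` (row D, reads `nt`), `sdCellAnyZN` (side condition, reads `nt`); evaluators `…FinX3Eval`; constants from the compiled design probe (x3probe/x3plan, margins c ×0.985, b ×1.03, aD ×1.03); assembled in `…FinX3GM3TwentyFive`.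
Prover seat `hubbard-h0-rotor-p3` g8; helper for piece A = stmt-HubbardSuperconductivity-23918 of rung 19089 (`--supports`, helper class).
WHAT THIS IS NOT: nothing here proves superconductivity in the Hubbard model (rotor TARGET as worded stays FALSE, g15 verdict); kernel facts for the FIN certificate of ONE conditional reduction.  Tree imports only; zero data; standard axioms.
-/

set_option linter.dupNamespace false
set_option autoImplicit false

namespace Summit.HubbardSuperconductivity.HubbardSuperconductivity.Theorems.AnisotropyChord.Transfer.Fibre3

namespace FinXD

open FinXB FinCell Hole2

set_option maxHeartbeats 4000000 in
/-- row `N₁` of cell 73 of `L = 25` (`c = 3/5`), exporting `nt`, `tb`. [folklore] -/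
theorem xn25_73 : xbnCellAny2 25 (49/50 : ℚ) 519490258599366 532477515064351 (3/5 : ℚ) ((-2677378789128 : ℤ), (4853454245211 : ℤ)) ((1555783884858239 : ℤ), (1602295511588995 : ℤ)) = true := by decide +kernel

set_option maxHeartbeats 4000000 in
/-- row D of cell 73 of `L = 25` (`aD = 81/1000`). [folklore] -/
theorem xd25_73 : xdCellAnyN0 25 (49/50 : ℚ) 519490258599366 532477515064351 (81/1000 : ℚ) ((-2677378789128 : ℤ), (4853454245211 : ℤ)) = true := by decide +kernel

set_option maxHeartbeats 4000000 in
/-- side condition of cell 73 of `L = 25` (`c, b = 62/100, aD`). [folklore] -/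
theorem sd25_73 : sdCellAnyZN 25 (49/50 : ℚ) 100 519490258599366 532477515064351 ((3/5 : ℚ), (62 : ℕ), (81/1000 : ℚ)) ((-2677378789128 : ℤ), (4853454245211 : ℤ)) = true := by decide +kernel

set_option maxHeartbeats 4000000 in
/-- row `N₁` of cell 74 of `L = 25` (`c = 3/5`), exporting `nt`, `tb`. [folklore] -/
theorem xn25_74 : xbnCellAny2 25 (49/50 : ℚ) 532477515064351 545789452940960 (3/5 : ℚ) ((-2593129273686 : ℤ), (4925985733256 : ℤ)) ((1594829665964868 : ℤ), (1642304094510635 : ℤ)) = true := by decide +kernel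

set_option maxHeartbeats 4000000 in
/-- row D of cell 74 of `L = 25` (`aD = 81/1000`). [folklore] -/
theorem xd25_74 : xdCellAnyN0 25 (49/50 : ℚ) 532477515064351 545789452940960 (81/1000 : ℚ) ((-2593129273686 : ℤ), (4925985733256 : ℤ)) = true := by decide +kernel

set_option maxHeartbeats 4000000 in
/-- side condition of cell 74 of `L = 25` (`c, b = 63/100, aD`). [folklore] -/
theorem sd25_74 : sdCellAnyZN 25 (49/50 : ℚ) 100 532477515064351 545789452940960 ((3/5 : ℚ), (63 : ℕ), (81/1000 : ℚ)) ((-2593129273686 : ℤ), (4925985733256 : ℤ)) = true := by decide +kernel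

end FinXD

end Summit.HubbardSuperconductivity.HubbardSuperconductivity.Theorems.AnisotropyChord.Transfer.Fibre3
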